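import Literature.Computability.AlgebraicComplexity.LRCanonicalSubspaces
import HarnessLib

/-!
# Canonical subspaces of a Grenet-shaped pencil are the up-set coordinate subspaces

Topic `Literature/Computability/AlgebraicComplexity`.  Companion of `LRCanonicalSubspaces.lean`
(canonical subspaces `𝒫_S = canon Λ A S` of a pencil `Λ + ∑ x_{pq} A_{pq}`, covariance
`B 𝒫_S = 𝒫_{σ S}` under exact lifts) and of `GeneralisedGrenetMatrix.lean` (generalised Grenet
matrices: Grenet's `(univ, ∅)` minor with arbitrary linear forms on the arcs `S → S ∪ {p}` of the
subset lattice; LR17 §2.2, §6).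

A pencil on `K^ι` is GRENET-SHAPED when the coordinates are labelled by subsets — rows by
`row i ≠ univ`, columns by `col j ≠ ∅`, bijectively — and `Λ` is `ε` times the partial identity
`[row i = col j]` while `A_{pq}` is supported on the arcs: `(A_{pq} w)_i = b (row i) p q · w_j` for
`p ∉ row i`, `col j = row i ∪ {p}`, and `0` if `p ∈ row i` (the pencil of a generalised Grenet
matrix).  As in `GeneralisedGrenetMatrix.lean` there are no definitions: the shape enters through
hypotheses `hΛv`, `hΛ0`, `hAv`, `hA0` on the action of `Λ`, `A_{pq}`, and the UP-SET COORDINATE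
SUBSPACES `𝒰_row(S) = {v : v_i = 0 unless S ⊆ row i}`, `𝒰_col(S)` enter through their membership
conditions `hUr`, `hUc`.

* `comap_Ur_eq_Uc` — `Λ⁻¹ 𝒰_row(S) = 𝒰_col(S)`;
* `map_comap_Ur_le`, `canon_le_Ur_compl` — `𝒰_row(S'ᶜ)` is closed under the rows in `S'`, so
  `𝒫_{S'} ⊆ 𝒰_row(S'ᶜ)` (the chain from `ker Λ = K e_{col univ}` only removes elements of `S'`);
* `Ur_compl_le_canon`, `canon_eq_Ur_compl` — conversely, if every `𝒫_{S'}`, `S' ≠ ∅`, is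
  CANONICALLY NEW (`𝒫_{S'} ⊄ ∑_{R ⊊ S'} 𝒫_R`, which `LRWeightCount.lean` derives from a torus datum
  with an injective member and all permutation lifts), then `𝒫_{S'} = 𝒰_row(S'ᶜ)` for every `S'`
  (induction on `S'`: `𝒰_row(S'ᶜ) = K e_{row S'ᶜ} ⊕ ∑_{R ⊊ S'} 𝒰_row(Rᶜ)`);
* `map_Ur_eq`, `map_Uc_eq` — hence an exact lift `(B, C)` of a row permutation `σ` satisfies
  `B 𝒰_row(S) = 𝒰_row(σ S)` and `C 𝒰_col(S) = 𝒰_col(σ S)` (covariance of `𝒫_S` transported).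

Used in `GrenetPencilOrbitProportional.lean` (the level forms of a left-equivariant generalised
Grenet matrix are proportional: symmetry half of the equality case of LR17 Thm. 2.8).

## References

* J. M. Landsberg, N. Ressayre, *Permanent v. determinant: an exponential lower bound assuming
  symmetry and a potential path towards Valiant's conjecture*, Differential Geom. Appl. 55 (2017)
  146–166, arXiv:1508.05788, §2.2 (Grenet's graded representation) and §6 (proof of Thm. 2.8)
  (key `LandsbergRessayre2017`).
* B. Grenet, *An upper bound for the permanent versus determinant problem* (2011), Thm. 1
  (key `Grenet2011`).
-/

noncomputable section

namespace Literature.Computability.AlgebraicComplexity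

namespace LRPencil

open Submodule Finset

variable {K : Type*} [Field K] {N : ℕ} {ι : Type*}
  {row col : ι → Finset (Fin N)} {ε : K} {b : Finset (Fin N) → Fin N → Fin N → K}
  {Λ : Module.End K (ι → K)} {A : Fin N → Fin N → Module.End K (ι → K)}
  {Ur Uc : Finset (Fin N) → Submodule K (ι → K)}

/-! ### Complements and permutations -/

/-- `σ(Sᶜ) = (σ S)ᶜ` for a permutation `σ`. [folklore] -/
theorem compl_map_perm (σ : Equiv.Perm (Fin N)) (S : Finset (Fin N)) :
    Sᶜ.map σ.toEmbedding = (S.map σ.toEmbedding)ᶜ := by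
  ext x
  simp only [mem_map_equiv, mem_compl]

/-! ### The Grenet shape: hypotheses -/

variable
  (hrow_inj : Function.Injective row) (hrow_ne : ∀ i, row i ≠ univ)
  (hrow_ex : ∀ S, S ≠ univ → ∃ i, row i = S)
  (hcol_inj : Function.Injective col) (hcol_ex : ∀ T, T ≠ ∅ → ∃ j, col j = T)
  (hε : ε ≠ 0)
  (hΛv : ∀ (v : ι → K) (i j : ι), col j = row i → Λ v i = ε * v j)
  (hΛ0 : ∀ (v : ι → K) (i : ι), row i = ∅ → Λ v i = 0)
  (hAv : ∀ (p q : Fin N) (w : ι → K) (i j : ι), p ∉ row i → col j = insert p (row i) →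
    A p q w i = b (row i) p q * w j)
  (hA0 : ∀ (p q : Fin N) (w : ι → K) (i : ι), p ∈ row i → A p q w i = 0)
  (hUr : ∀ (S : Finset (Fin N)) (v : ι → K), v ∈ Ur S ↔ ∀ i, ¬ S ⊆ row i → v i = 0)
  (hUc : ∀ (S : Finset (Fin N)) (w : ι → K), w ∈ Uc S ↔ ∀ j, ¬ S ⊆ col j → w j = 0)

/-! ### `Λ⁻¹` of an up-set subspace, closedness, the upper bound -/

include hrow_ex hcol_ex hε hΛv hΛ0 hUr hUc in
/-- `Λ⁻¹ 𝒰_row(S) = 𝒰_col(S)`: `Λ` sends `e_{col T}` to `ε e_{row T}` (`T ≠ univ`) and kills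
`e_{col univ}`. [cite: LandsbergRessayre2017, §2.2] -/
theorem comap_Ur_eq_Uc (S : Finset (Fin N)) : (Ur S).comap Λ = Uc S := by
  ext v
  rw [Submodule.mem_comap, hUr, hUc]
  constructor
  · intro h j hj
    have hju : col j ≠ univ := fun e => hj (e ▸ subset_univ S)
    obtain ⟨i, hi⟩ := hrow_ex _ hju
    have h1 := hΛv v i j hi.symm
    rw [h i (by rwa [hi])] at h1
    exact (mul_eq_zero.1 h1.symm).resolve_left hε
  · intro h i hi
    by_cases h0 : row i = ∅
    · exact hΛ0 v i h0
    · obtain ⟨j, hj⟩ := hcol_ex _ h0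
      rw [hΛv v i j hj, h j (by rwa [hj]), mul_zero]

include hrow_ex hcol_ex hε hΛv hΛ0 hAv hA0 hUr hUc in
/-- `𝒰_row(S₀)` is closed under the rows NOT in `S₀`: `A_{kq} (Λ⁻¹ 𝒰_row(S₀)) ⊆ 𝒰_row(S₀)` for
`k ∉ S₀` (an arc `row i → row i ∪ {k}` starting above `S₀` ends above `S₀`). [cite: LandsbergRessayre2017, §6] -/
theorem map_comap_Ur_le {S₀ : Finset (Fin N)} {k : Fin N} (hk : k ∉ S₀) (q : Fin N) :
    ((Ur S₀).comap Λ).map (A k q) ≤ Ur S₀ := by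
  rw [comap_Ur_eq_Uc hrow_ex hcol_ex hε hΛv hΛ0 hUr hUc, Submodule.map_le_iff_le_comap]
  intro w hw
  rw [Submodule.mem_comap, hUr]
  rw [hUc] at hw
  intro i hi
  by_cases hki : k ∈ row i
  · exact hA0 k q w i hki
  · obtain ⟨j, hj⟩ := hcol_ex _ (insert_ne_empty k (row i))
    rw [hAv k q w i j hki hj, hw j ?_, mul_zero]
    intro hsub
    rw [hj, subset_insert_iff_of_notMem hk] at hsub
    exact hi hsub

include hrow_ex hcol_ex hε hΛv hΛ0 hAv hA0 hUr hUc in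
/-- **Upper bound**: `𝒫_{S'} ⊆ 𝒰_row(S'ᶜ)` — the canonical subspace of the rows in `S'` lives on
the rows `T ⊇ S'ᶜ`. [cite: LandsbergRessayre2017, §6] -/
theorem canon_le_Ur_compl (S' : Finset (Fin N)) : canon Λ A S' ≤ Ur S'ᶜ :=
  canon_le fun k hk q => map_comap_Ur_le hrow_ex hcol_ex hε hΛv hΛ0 hAv hA0 hUr hUc
    (show k ∉ S'ᶜ from fun h => (mem_compl.1 h) hk) q

/-! ### Transport along an exact lift of a row permutation -/

/-- If `𝒫_{S'} = 𝒰_row(S'ᶜ)` for all `S'`, an exact lift `(B, C)` of `σ` maps `𝒰_row(S)` onto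
`𝒰_row(σ S)` (covariance `B 𝒫_{Sᶜ} = 𝒫_{σ Sᶜ}`). [cite: LandsbergRessayre2017, §6] -/
theorem map_Ur_eq (hcanon : ∀ S' : Finset (Fin N), canon Λ A S' = Ur S'ᶜ)
    {σ : Equiv.Perm (Fin N)} {c : Fin N → K} (L : Lift Λ A σ c) (S : Finset (Fin N)) :
    (Ur S).map (L.B : (ι → K) →ₗ[K] (ι → K)) = Ur (S.map σ.toEmbedding) := by
  have h1 : Ur S = canon Λ A Sᶜ := by rw [hcanon, compl_compl]
  rw [h1, L.map_canon_eq, hcanon, compl_map_perm, compl_compl]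

/-- … and then `C 𝒰_col(S) = 𝒰_col(σ S)` (apply `Λ⁻¹`: `Λ⁻¹ (B P) = C (Λ⁻¹ P)`). [cite: LandsbergRessayre2017, §6] -/
theorem map_Uc_eq (hcomap : ∀ S : Finset (Fin N), (Ur S).comap Λ = Uc S)
    {σ : Equiv.Perm (Fin N)} {c : Fin N → K} (L : Lift Λ A σ c)
    (hB : ∀ S : Finset (Fin N), (Ur S).map (L.B : (ι → K) →ₗ[K] (ι → K)) = Ur (S.map σ.toEmbedding))
    (S : Finset (Fin N)) :
    (Uc S).map (L.C : (ι → K) →ₗ[K] (ι → K)) = Uc (S.map σ.toEmbedding) := by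
  rw [← hcomap, ← L.comap_map_eq, hB, hcomap]

/-! ### The lower bound from canonical newness -/

include hrow_ne hUr in
/-- `𝒰_row(univ) = 0`: no row is labelled `univ`. [folklore] -/
theorem Ur_univ_eq_bot : Ur (univ : Finset (Fin N)) = ⊥ := by
  rw [eq_bot_iff]
  intro v hv
  rw [hUr] at hv
  rw [Submodule.mem_bot]
  funext i
  exact hv i fun h => hrow_ne i (univ_subset_iff.1 h)

variable [Fintype ι] [DecidableEq ι]

include hrow_inj hUr in
/-- `𝒰_row(S'ᶜ) ⊆ K e_{i₀} + ∑_{R ⊊ S'} 𝒰_row(Rᶜ)` where `row i₀ = S'ᶜ`: a row `T ⊋ S'ᶜ` lies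
above `Rᶜ = T` with `R = Tᶜ ⊊ S'`. [folklore] -/
theorem Ur_compl_le_span_sup {S' : Finset (Fin N)} {i₀ : ι} (hi₀ : row i₀ = S'ᶜ) :
    Ur S'ᶜ ≤ (K ∙ (Pi.single i₀ 1 : ι → K)) ⊔ ⨆ (R : Finset (Fin N)) (_ : R ⊂ S'), Ur Rᶜ := by
  intro v hv
  rw [hUr] at hv
  rw [← Finset.univ_sum_single v]
  refine Submodule.sum_mem _ fun i _ => ?_
  by_cases hvi : v i = 0
  · rw [hvi, Pi.single_zero]; exact Submodule.zero_mem _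
  have hsub : S'ᶜ ⊆ row i := by
    by_contra h
    exact hvi (hv i h)
  by_cases hi : i = i₀
  · subst hi
    refine Submodule.mem_sup_left (Submodule.mem_span_singleton.2 ⟨v i, ?_⟩)
    ext i'
    by_cases h' : i' = i
    · subst h'; simp
    · simp [Pi.single_eq_of_ne h']
  · have hne : row i ≠ S'ᶜ := fun h => hi (hrow_inj (h.trans hi₀.symm))
    have hR : (row i)ᶜ ⊂ S' := by
      rw [Finset.ssubset_iff_subset_ne]
      refine ⟨fun x hx => ?_, fun h => hne ?_⟩
      · by_contra hxS
        exact (mem_compl.1 hx) (hsub (mem_compl.2 hxS))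
      · rw [← h, compl_compl]
    refine Submodule.mem_sup_right
      (Submodule.mem_iSup_of_mem (row i)ᶜ (Submodule.mem_iSup_of_mem hR ?_))
    rw [hUr, compl_compl]
    intro i' hi'
    exact Pi.single_eq_of_ne (fun h => hi' (by rw [h])) _

include hrow_inj hrow_ne hrow_ex hcol_ex hε hΛv hΛ0 hAv hA0 hUr hUc in
/-- **Lower bound from canonical newness**: if `𝒫_{S'} ⊄ ∑_{R ⊊ S'} 𝒫_R` for every `S' ≠ ∅`,
then `𝒰_row(S'ᶜ) ⊆ 𝒫_{S'}` for every `S'` (induction on `S'`: `𝒫_{S'}` lies between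
`∑_{R ⊊ S'} 𝒫_R = ∑_{R ⊊ S'} 𝒰_row(Rᶜ)` and `𝒰_row(S'ᶜ)`, which differ by the line `K e_{row S'ᶜ}`).
[cite: LandsbergRessayre2017, §6] -/
theorem Ur_compl_le_canon
    (hnew : ∀ S' : Finset (Fin N), S' ≠ ∅ →
      ¬ canon Λ A S' ≤ ⨆ (R : Finset (Fin N)) (_ : R ⊂ S'), canon Λ A R)
    (S' : Finset (Fin N)) : Ur S'ᶜ ≤ canon Λ A S' := by
  induction S' using Finset.strongInduction with
  | H S' ih =>
  by_cases hS : S' = ∅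
  · subst hS
    rw [Finset.compl_empty, Ur_univ_eq_bot hrow_ne hUr]
    exact bot_le
  set Q : Submodule K (ι → K) := ⨆ (R : Finset (Fin N)) (_ : R ⊂ S'), canon Λ A R with hQdef
  have hQ : Q ≤ canon Λ A S' := iSup₂_le fun R hR => canon_mono (subset_of_ssubset hR)
  have hUQ : (⨆ (R : Finset (Fin N)) (_ : R ⊂ S'), Ur Rᶜ) ≤ Q :=
    iSup₂_le fun R hR => (ih R hR).trans (le_iSup₂ (f := fun R (_ : R ⊂ S') => canon Λ A R) R hR)
  have hcu : S'ᶜ ≠ univ := fun h => hS ((compl_eq_univ_iff _).1 h)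
  obtain ⟨i₀, hi₀⟩ := hrow_ex _ hcu
  have hdec := Ur_compl_le_span_sup (K := K) hrow_inj hUr hi₀
  have hup : canon Λ A S' ≤ Ur S'ᶜ :=
    canon_le_Ur_compl hrow_ex hcol_ex hε hΛv hΛ0 hAv hA0 hUr hUc S'
  obtain ⟨w, hw, hwQ⟩ := SetLike.not_le_iff_exists.1 (hnew S' hS)
  obtain ⟨y, hy, z, hz, hyz⟩ := Submodule.mem_sup.1 (hdec (hup hw))
  obtain ⟨t, rfl⟩ := Submodule.mem_span_singleton.1 hy
  have hzQ : z ∈ Q := hUQ hz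
  have ht : t ≠ 0 := by
    rintro rfl
    apply hwQ
    rw [← hyz, zero_smul, zero_add]
    exact hzQ
  have he : (Pi.single i₀ 1 : ι → K) ∈ canon Λ A S' := by
    have : (Pi.single i₀ 1 : ι → K) = t⁻¹ • (w - z) := by
      rw [← hyz, add_sub_cancel_right, smul_smul, inv_mul_cancel₀ ht, one_smul]
    rw [this]
    exact Submodule.smul_mem _ _ (Submodule.sub_mem _ hw (hQ hzQ))
  calc Ur S'ᶜ ≤ (K ∙ (Pi.single i₀ 1 : ι → K)) ⊔ ⨆ (R : Finset (Fin N)) (_ : R ⊂ S'), Ur Rᶜ := hdec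
    _ ≤ canon Λ A S' := sup_le ((Submodule.span_singleton_le_iff_mem _ _).2 he) (hUQ.trans hQ)

include hrow_inj hrow_ne hrow_ex hcol_ex hε hΛv hΛ0 hAv hA0 hUr hUc in
/-- **The canonical subspaces of a Grenet-shaped pencil**: under canonical newness,
`𝒫_{S'} = 𝒰_row(S'ᶜ)` — the span of the rows `T ⊇ S'ᶜ` — for every `S'`. [cite: LandsbergRessayre2017, §6] -/
theorem canon_eq_Ur_compl
    (hnew : ∀ S' : Finset (Fin N), S' ≠ ∅ →
      ¬ canon Λ A S' ≤ ⨆ (R : Finset (Fin N)) (_ : R ⊂ S'), canon Λ A R)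
    (S' : Finset (Fin N)) : canon Λ A S' = Ur S'ᶜ :=
  le_antisymm (canon_le_Ur_compl hrow_ex hcol_ex hε hΛv hΛ0 hAv hA0 hUr hUc S')
    (Ur_compl_le_canon hrow_inj hrow_ne hrow_ex hcol_ex hε hΛv hΛ0 hAv hA0 hUr hUc hnew S')

end LRPencil

end Literature.Computability.AlgebraicComplexity
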